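import Mathlib
import HarnessLib
import Summits.CriticalPhenomena.SAWScalingLimit.Theses.SAWDefectDecoherence
import Literature.Probability.RandomPlanarGeometry.HexParafermion
import Literature.Probability.RandomPlanarGeometry.HexSAW

/-!
# Sketch — crux ideas for `DefectDecoherence` (stmt-CriticalPhenomena-8549), ideator 3, round 1

First lemmas of the idea cards `loop-dressed-clean-arrival` and `sector-slaving`
(folder `Ideas/`). Nothing here is proved; the point is that the signatures elaborate over
existing declarations (`HexMidEdgeSAW`, `hexParafermionicObservable`, `hexCriticalFugacity`,
`hexMidpoint`, `hexCenter`, `hexGraph`, `hexDomainSimplyConnected`).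
-/

namespace Summit.CriticalPhenomena.SAWScalingLimit.Cruxes.DefectDecoherence.Sketch

open Literature.Probability.RandomPlanarGeometry.SAW Literature.Probability.LatticeModels
open scoped BigOperators ComplexConjugate
open Classical

noncomputable section

/-- The part of the observable at the mid-edge `z` carried by walks whose LAST visited vertex is
`p` (for `z = s(v,t)`: `p = v` is "via v", `p = t` is "via t"). -/
def obsVia (Λ : Finset HexVertex) (a : Sym2 HexVertex) (x σ : ℝ) (z : Sym2 HexVertex)
    (p : HexVertex) : ℂ :=
  ∑ γ : HexMidEdgeSAW Λ a z, if γ.verts.getLast? = some p then γ.weight x σ else 0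

/-- Clean via-`t` part at the mid-edge `{v,t}`: last vertex `t` and `v` never visited
(Elvey Price–de Gier–Guttmann–Lee's `F(p;v)` at `n = 0`). -/
def obsViaClean (Λ : Finset HexVertex) (a : Sym2 HexVertex) (x σ : ℝ) (v t : HexVertex) : ℂ :=
  ∑ γ : HexMidEdgeSAW Λ a s(v, t),
    if γ.verts.getLast? = some t ∧ v ∉ γ.verts then γ.weight x σ else 0

/-- Dirty via-`t` part at `{v,t}`: last vertex `t`, `v` visited earlier (DCS's paired walks). -/
def obsViaDirty (Λ : Finset HexVertex) (a : Sym2 HexVertex) (x σ : ℝ) (v t : HexVertex) : ℂ :=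
  ∑ γ : HexMidEdgeSAW Λ a s(v, t),
    if γ.verts.getLast? = some t ∧ v ∈ γ.verts then γ.weight x σ else 0

/-- The crux's conjugated star coefficient `conj(mid{v,t} − c_v)`. -/
def conjCoef (v t : HexVertex) : ℂ := (starRingEnd ℂ) (hexMidpoint s(v, t) - hexCenter v)

/-- CARD `loop-dressed-clean-arrival`, First lemma (TipOneStep, exact, provable now):
at `x = x_c`, `σ = 5/8`, the via-`v` part of the conjugated star sum equals
`2 x_c sin(π/24)` times its clean via-`t` part (the triplet regrouping of DCS/EPdGGL evaluated at the
DEFECT frequency: `1 − 2x_c cos(13π/24) = 1 + 2x_c sin(π/24)` instead of `1 − 2x_c cos(π/8) = 0`). -/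
def TipOneStep : Prop :=
  ∀ (Λ : Finset HexVertex) (a : Sym2 HexVertex) (v : HexVertex), v ∈ Λ →
    (∀ t : HexVertex, hexGraph.Adj v t → t ∈ Λ) →
    (∑ t ∈ Λ.filter (fun t => hexGraph.Adj v t),
        conjCoef v t * obsVia Λ a hexCriticalFugacity (5 / 8) s(v, t) v)
      = (2 * hexCriticalFugacity * Real.sin (Real.pi / 24) : ℂ) *
        ∑ t ∈ Λ.filter (fun t => hexGraph.Adj v t),
          conjCoef v t * obsViaClean Λ a hexCriticalFugacity (5 / 8) v t

/-- Twisted clean-arrival sum at the VERTEX `z`: over vertex-SAWs `ω : a → z` (arriving at `z`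
through a neighbour `s`, `z` visited last), `Σ x_c^{|ω|} e^{−iξ Θ_in(ω)}`, `Θ_in = θ_a + W` the
LIFTED arrival direction (`θ_a` = direction of the root dart). `ξ = 0` gives the clean arrival
mass; `ξ ∈ {−3/8, 5/8, 13/8}` are the three ℤ/3-sectors `U, S, D`. -/
def arrivalSum (Λ : Finset HexVertex) (a : Sym2 HexVertex) (θa ξ : ℝ) (z : HexVertex) : ℂ :=
  ∑ s ∈ Λ.filter (fun s => hexGraph.Adj z s), ∑ γ : HexMidEdgeSAW Λ a s(s, z),
    if γ.verts.getLast? = some s ∧ z ∉ γ.verts then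
      (hexCriticalFugacity : ℂ) ^ (γ.length + 1) *
        Complex.exp (-Complex.I * (ξ : ℂ) * ((θa + γ.winding : ℝ) : ℂ))
    else 0

/-- CARD `sector-slaving`, First lemma (USectorPoisson = the `U`-row of the exact sector system,
provable now): at a 2-deep vertex `v` of a simply connected domain with boundary root `a = {u,w}`,
the unstable sector `U = A(−3/8)` is the neighbour average of itself plus `2x_c cos(5π/24)/3` times the
discrete ∂̄-type difference of the signal sector `S = A(5/8)` plus `2x_c cos(13π/24)/3` times the
discrete ∂-type difference of the defect sector `D = A(13/8)` — with NO loop (dirty) term: its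
vanishing is exactly DCS's pair cancellation. (`e t` = unit vector of the dart `t → v`.) -/
def USectorPoisson : Prop :=
  ∀ (Λ : Finset HexVertex), hexDomainSimplyConnected Λ →
    ∀ (u w : HexVertex), hexGraph.Adj u w → u ∉ Λ → w ∈ Λ →
    ∀ v : HexVertex, (∀ y : HexVertex, dist (hexCenter y) (hexCenter v) ≤ 2 → y ∈ Λ) →
    let θa : ℝ := Complex.arg (hexCenter w - hexCenter u)
    let A : ℝ → HexVertex → ℂ := fun ξ z => arrivalSum Λ s(u, w) θa ξ z
    let e : HexVertex → ℂ := fun t =>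
      (hexCenter v - hexCenter t) / ((‖hexCenter v - hexCenter t‖ : ℝ) : ℂ)
    A (-3 / 8) v =
      ∑ t ∈ Λ.filter (fun t => hexGraph.Adj v t),
        ((1 / 3 : ℂ) * A (-3 / 8) t
          + (2 * hexCriticalFugacity * Real.cos (5 * Real.pi / 24) / 3 : ℂ) * e t * A (5 / 8) t
          + (2 * hexCriticalFugacity * Real.cos (13 * Real.pi / 24) / 3 : ℂ) * e t ^ 2 * A (13 / 8) t)

/-- CARD `sector-slaving`, the exact `D`-row (with the loop term made explicit as the through-`v`
arrivals at the neighbours): informal in the card; here only its dirty functional. Through-`v`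
arrivals at a neighbour `t`, pushed to `v` (one more step, one more turn `τ` towards `v`):
`Σ x_c^{|ω'|+1} e^{−iξ(Θ_in(ω') + τπ/3)}` — written with the mid-edge walk to `s(t, v)` via `t`
that HAS visited `v` (its final half-edge points `t → v`, so `θ_a + W` is already the pushed angle). -/
def dirtySum (Λ : Finset HexVertex) (a : Sym2 HexVertex) (θa ξ : ℝ) (v : HexVertex) : ℂ :=
  ∑ t ∈ Λ.filter (fun t => hexGraph.Adj v t), ∑ γ : HexMidEdgeSAW Λ a s(t, v),
    if γ.verts.getLast? = some t ∧ v ∈ γ.verts then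
      (hexCriticalFugacity : ℂ) ^ (γ.length + 1) *
        Complex.exp (-Complex.I * (ξ : ℂ) * ((θa + γ.winding : ℝ) : ℂ))
    else 0

/-- The full sector system (SYS), all three rows, exact (verified by enumeration to 1e-14 on discs of
25–46 vertices): for `ξ' ∈ {−3/8, 5/8, 13/8}`,
`A(ξ') v + Dirty(ξ') v = Σ_{ξ_s} 2x_c cos(ξ_s π/3)/3 · Σ_t e(t)^{ξ_s−ξ'} A(ξ_s) t`, and `Dirty(−3/8) = 0`. -/
def SectorSystem : Prop :=
  ∀ (Λ : Finset HexVertex), hexDomainSimplyConnected Λ →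
    ∀ (u w : HexVertex), hexGraph.Adj u w → u ∉ Λ → w ∈ Λ →
    ∀ v : HexVertex, (∀ y : HexVertex, dist (hexCenter y) (hexCenter v) ≤ 2 → y ∈ Λ) →
    let θa : ℝ := Complex.arg (hexCenter w - hexCenter u)
    let A : ℝ → HexVertex → ℂ := fun ξ z => arrivalSum Λ s(u, w) θa ξ z
    let e : HexVertex → ℂ := fun t =>
      (hexCenter v - hexCenter t) / ((‖hexCenter v - hexCenter t‖ : ℝ) : ℂ)
    ∀ k' : Fin 3,
      let ξ' : ℝ := (-(3 : ℝ) / 8) + (k' : ℕ)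
      A ξ' v + dirtySum Λ s(u, w) θa ξ' v =
        ∑ k : Fin 3, ∑ t ∈ Λ.filter (fun t => hexGraph.Adj v t),
          (2 * hexCriticalFugacity * Real.cos (((-(3 : ℝ) / 8) + (k : ℕ)) * Real.pi / 3) / 3 : ℂ) *
            e t ^ ((k : ℤ) - (k' : ℤ)) * A ((-(3 : ℝ) / 8) + (k : ℕ)) t

/-- Transfer target of CARD `loop-dressed-clean-arrival` (clean half): twisted clean-arrival sums
at the defect frequency `13/8` decay against the clean arrival mass. -/
def CleanArrivalDecoherence : Prop :=
  ∃ C θ : ℝ, 3 / 4 < θ ∧ ∀ (Λ : Finset HexVertex), hexDomainSimplyConnected Λ →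
    ∀ (u w : HexVertex), hexGraph.Adj u w → u ∉ Λ → w ∈ Λ →
    ∀ (v : HexVertex) (R : ℝ), 1 ≤ R →
      (∀ y : HexVertex, dist (hexCenter y) (hexCenter v) ≤ R → y ∈ Λ) →
      ‖arrivalSum Λ s(u, w) (Complex.arg (hexCenter w - hexCenter u)) (13 / 8) v‖
        ≤ C * R ^ (-θ) * (arrivalSum Λ s(u, w) 0 0 v).re

/-- Transfer target of CARD `loop-dressed-clean-arrival` (dirty half): the conjugated star sum over
the DIRTY walks alone (equivalently the loop-dressed clean-arrival sum `A_N`) decays against the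
star mass. -/
def DirtyDecoherence : Prop :=
  ∃ C θ : ℝ, 3 / 4 < θ ∧ ∀ (Λ : Finset HexVertex), hexDomainSimplyConnected Λ →
    ∀ (u w : HexVertex), hexGraph.Adj u w → u ∉ Λ → w ∈ Λ →
    ∀ (v : HexVertex) (R : ℝ), 1 ≤ R →
      (∀ y : HexVertex, dist (hexCenter y) (hexCenter v) ≤ R → y ∈ Λ) →
      ‖∑ t ∈ Λ.filter (fun t => hexGraph.Adj v t),
          conjCoef v t * obsViaDirty Λ s(u, w) hexCriticalFugacity (5 / 8) v t‖
        ≤ C * R ^ (-θ) * ∑ t ∈ Λ.filter (fun t => hexGraph.Adj v t),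
          ‖hexParafermionicObservable Λ s(u, w) hexCriticalFugacity 0 s(v, t)‖

/-- Transfer target of CARD `sector-slaving`: neighbour oscillation of the two FREE sectors
(`S = 5/8`, `U = −3/8`) over the three neighbours of an `R`-deep vertex, against the clean arrival
mass at `v`. -/
def SectorRegularity : Prop :=
  ∃ C θ : ℝ, 3 / 4 < θ ∧ ∀ (Λ : Finset HexVertex), hexDomainSimplyConnected Λ →
    ∀ (u w : HexVertex), hexGraph.Adj u w → u ∉ Λ → w ∈ Λ →
    ∀ (v : HexVertex) (R : ℝ), 2 ≤ R →
      (∀ y : HexVertex, dist (hexCenter y) (hexCenter v) ≤ R → y ∈ Λ) →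
      ∀ ξ ∈ ({-3 / 8, 5 / 8} : Set ℝ), ∀ t t' : HexVertex, hexGraph.Adj v t → hexGraph.Adj v t' →
        ‖arrivalSum Λ s(u, w) (Complex.arg (hexCenter w - hexCenter u)) ξ t
            - arrivalSum Λ s(u, w) (Complex.arg (hexCenter w - hexCenter u)) ξ t'‖
          ≤ C * R ^ (-θ) * (arrivalSum Λ s(u, w) 0 0 v).re

/-- The shape of the two transfers (informal; the card states them): -/
def TransferShape : Prop :=
  (TipOneStep → CleanArrivalDecoherence → DirtyDecoherence →
      Summit.CriticalPhenomena.SAWScalingLimit.Theses.SAWDefectDecoherence.DefectDecoherence) ∧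
  (SectorSystem → SectorRegularity → DirtyDecoherence →
      Summit.CriticalPhenomena.SAWScalingLimit.Theses.SAWDefectDecoherence.DefectDecoherence)

end

end Summit.CriticalPhenomena.SAWScalingLimit.Cruxes.DefectDecoherence.Sketch
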